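import Summits.SmoothPoincare4.SmoothPoincare4.Theses.CongruenceShadows

/-!
# `WaldhausenPairs` — negative-side support (4): normality is load-bearing

Refuter negative lemma (cdisprove seat, cycle 2) for crux item stmt-SmoothPoincare4-14592
(`CongruenceShadows.WaldhausenPairs`: for every balanced `(3+3m, m+1)` group trisection `K` of
the trivial group and every `i ≠ j`, ONE automorphism of `S_{3+3m}` carries the standard pair
`(N_i, N_j)` (`N = s4Kernels.stabilizeIter m`) onto `(K_i, K_j)`).

`waldhausenPairs_false_without_normal`: with the field `normal` of `IsGroupTrisection` dropped
(the three quotient conditions kept verbatim) the statement is FALSE.  Witness `m = 0`,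
`K = (⟨a₁,a₂,b₃⟩, N₁, N₂)` whose slot `0` is the subgroup GENERATED by `a₁, a₂, b₃` rather than
its normal closure `N₀`: all seven quotients of `K` coincide with those of `N` (they only see
normal closures), but `α(N₀) = K₀` would make `⟨a₁,a₂,b₃⟩` normal, which the representation
`ρ : S_3 → Sym(3)` (`a₁ ↦ (0 1)`, `b₁ ↦ (0 2)`, `a₂, b₂ ↦ 1`, `a₃ ↦ (0 2)`, `b₃ ↦ (0 1)`) refutes
(`ρ⟨a₁,a₂,b₃⟩ ≤ Stab(2)`, `ρ(b₁a₁b₁⁻¹) = (1 2)`).  With `LoadBearing.lean` (fields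
`free_quotient`, `free_pairQuotient`) this completes the load-bearing analysis of the hypothesis:
`normal`, `free_quotient`, `free_pairQuotient` are each necessary; `triple` is never used
(crux work file `Cruxes/WaldhausenPairs/Disproof.lean`, §C).
-/

-- the prescribed namespace `Summit.<P>.<Sub>.…` duplicates `SmoothPoincare4` (P = Sub)
set_option linter.dupNamespace false

noncomputable section

namespace Summit.SmoothPoincare4.SmoothPoincare4.Theorems.WaldhausenPairs.Negative

open Literature.Topology.FourManifolds Subgroup

/-! ## A representation `ρ : S_3 → Sym(3)` and the non-normal subgroup `⟨a₁, a₂, b₃⟩` -/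

/-- Generator images of a representation `ρ : S_3 → Sym(3)`: `a₁ ↦ (0 1)`, `b₁ ↦ (0 2)`,
`a₂, b₂ ↦ 1`, `a₃ ↦ (0 2)`, `b₃ ↦ (0 1)` (so `[ρa₁,ρb₁][ρa₂,ρb₂][ρa₃,ρb₃] = [s,t]·1·[t,s] = 1`).
[folklore] -/
def permGen (x : surfaceGen 3) : Equiv.Perm (Fin 3) :=
  if x = ((0 : Fin 3), false) then Equiv.swap 0 1
  else if x = ((0 : Fin 3), true) then Equiv.swap 0 2
  else if x = ((2 : Fin 3), false) then Equiv.swap 0 2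
  else if x = ((2 : Fin 3), true) then Equiv.swap 0 1
  else 1

/-- `ρ` kills the surface relator (kernel computation in `Sym(3)`). [folklore] -/
theorem lift_permGen_surfaceRelator : FreeGroup.lift permGen (surfaceRelator 3) = 1 := by
  decide

/-- The representation `ρ : S_3 → Sym(3)`. [folklore] -/
def permHom : SurfaceGroup 3 →* Equiv.Perm (Fin 3) :=
  presentedLift (FreeGroup.lift permGen) (by
    intro r hr
    rw [Set.mem_singleton_iff] at hr
    subst hr
    exact lift_permGen_surfaceRelator)

/-- `ρ` on `aᵢ`. [folklore] -/
theorem permHom_a (i : Fin 3) : permHom (SurfaceGroup.a i) = permGen (i, false) := by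
  simp [permHom, SurfaceGroup.a]

/-- `ρ` on `bᵢ`. [folklore] -/
theorem permHom_b (i : Fin 3) : permHom (SurfaceGroup.b i) = permGen (i, true) := by
  simp [permHom, SurfaceGroup.b]

/-- The subgroup GENERATED (not normally generated) by `a₁, a₂, b₃`. [folklore] -/
def badK0 : Subgroup (SurfaceGroup 3) :=
  Subgroup.closure {SurfaceGroup.a 0, SurfaceGroup.a 1, SurfaceGroup.b 2}

/-- `ρ(⟨a₁, a₂, b₃⟩)` fixes the point `2`. [folklore] -/
theorem map_permHom_badK0_le :
    badK0.map permHom ≤ MulAction.stabilizer (Equiv.Perm (Fin 3)) (2 : Fin 3) := by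
  rw [badK0, MonoidHom.map_closure, Subgroup.closure_le]
  rintro _ ⟨x, hx, rfl⟩
  simp only [Set.mem_insert_iff, Set.mem_singleton_iff] at hx
  rw [SetLike.mem_coe, MulAction.mem_stabilizer_iff]
  rcases hx with rfl | rfl | rfl
  · rw [permHom_a]; decide
  · rw [permHom_a]; decide
  · rw [permHom_b]; decide

/-- `⟨a₁, a₂, b₃⟩ ≤ S_3` is NOT normal: `ρ(b₁ a₁ b₁⁻¹) = (1 2)` moves `2`. [folklore] -/
theorem badK0_not_normal : ¬ (badK0).Normal := by
  intro hN
  have hmem : SurfaceGroup.b 0 * SurfaceGroup.a 0 * (SurfaceGroup.b 0)⁻¹ ∈ badK0 :=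
    hN.conj_mem _ (Subgroup.subset_closure (by simp)) _
  have h2 := map_permHom_badK0_le (Subgroup.mem_map_of_mem permHom hmem)
  rw [MulAction.mem_stabilizer_iff, map_mul, map_mul, map_inv, permHom_a, permHom_b] at h2
  revert h2
  decide

/-- The witness: slot `0` is the non-normal `⟨a₁,a₂,b₃⟩`, slots `1, 2` are standard. [folklore] -/
def badK : TrisectionKernels 3 := ![badK0, s4Kernels 1, s4Kernels 2]

/-- Normal closures of unions only see normal closures of the parts. [folklore] -/
theorem normalClosure_union_congr {G : Type*} [Group G] {A A' B B' : Set G}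
    (hA : normalClosure A = normalClosure A') (hB : normalClosure B = normalClosure B') :
    normalClosure (A ∪ B) = normalClosure (A' ∪ B') := by
  have key : ∀ {A A' B B' : Set G}, normalClosure A ≤ normalClosure A' →
      normalClosure B ≤ normalClosure B' → normalClosure (A ∪ B) ≤ normalClosure (A' ∪ B') := by
    intro A A' B B' hA hB
    refine normalClosure_le_normal (Set.union_subset ?_ ?_)
    · exact fun x hx => normalClosure_mono Set.subset_union_left (hA (subset_normalClosure hx))
    · exact fun x hx => normalClosure_mono Set.subset_union_right (hB (subset_normalClosure hx))
  exact le_antisymm (key hA.le hB.le) (key hA.ge hB.ge)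

/-- Same for indexed unions. [folklore] -/
theorem normalClosure_iUnion_congr {G : Type*} [Group G] {ι : Sort*} {A A' : ι → Set G}
    (h : ∀ i, normalClosure (A i) = normalClosure (A' i)) :
    normalClosure (⋃ i, A i) = normalClosure (⋃ i, A' i) := by
  have key : ∀ {A A' : ι → Set G}, (∀ i, normalClosure (A i) ≤ normalClosure (A' i)) →
      normalClosure (⋃ i, A i) ≤ normalClosure (⋃ i, A' i) := by
    intro A A' hA
    refine normalClosure_le_normal (Set.iUnion_subset fun i => ?_)
    exact fun x hx => normalClosure_mono (Set.subset_iUnion _ i) (hA i (subset_normalClosure hx))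
  exact le_antisymm (key fun i => (h i).le) (key fun i => (h i).ge)

/-- Slot by slot, the witness has the same normal closures as the standard triple. [folklore] -/
theorem normalClosure_badK (i : Fin 3) :
    normalClosure ((badK i : Subgroup (SurfaceGroup 3)) : Set (SurfaceGroup 3)) =
      normalClosure ((s4Kernels i : Subgroup (SurfaceGroup 3)) : Set (SurfaceGroup 3)) := by
  haveI : ∀ j, (s4Kernels j).Normal := s4Kernels_isGroupTrisection_holds.normal
  fin_cases i
  · have h0 : s4Kernels 0 = normalClosure {SurfaceGroup.a 0, SurfaceGroup.a 1, SurfaceGroup.b 2} := rfl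
    change normalClosure ((badK0 : Subgroup (SurfaceGroup 3)) : Set (SurfaceGroup 3)) =
      normalClosure ((s4Kernels 0 : Subgroup (SurfaceGroup 3)) : Set (SurfaceGroup 3))
    rw [normalClosure_eq_self (s4Kernels 0), h0, badK0, normalClosure_closure_eq_normalClosure]
  · rfl
  · rfl

/-- LOAD-BEARING (normality): with `normal` dropped the crux is FALSE.  Witness `m = 0`,
`K = (⟨a₁,a₂,b₃⟩, N₁, N₂)` with slot `0` the subgroup GENERATED by `a₁, a₂, b₃` (not its normal
closure `N₀`): every quotient condition of `IsGroupTrisection` only sees normal closures, so `K`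
has exactly the seven quotients of `N`, but `α(N₀) = K₀` is impossible because `α(N₀)` is normal
and `⟨a₁,a₂,b₃⟩` is not (`badK0_not_normal`, via `ρ : S_3 → Sym(3)`).  Moral for provers: the
conclusion `(N i).map α = K i` silently re-asserts normality of `K i`; the quotient data never
do, so `hK.normal i`, `hK.normal j` must be fed to the realisation step (they are: S1 of every
line takes `A.Normal`, `B.Normal`).  This completes the load-bearing table of the four fields of
`IsGroupTrisection`: `normal` (here), `free_quotient`, `free_pairQuotient` (`LoadBearing.lean`)
are each necessary; `triple` is never needed (crux work file, §C). [folklore] -/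
theorem waldhausenPairs_false_without_normal :
    ¬ (∀ (m : ℕ) (K : TrisectionKernels (3 + 3 * m)),
      (∀ i, IsFreeOfRank (SurfaceGroup (3 + 3 * m) ⧸
        normalClosure (K i : Set (SurfaceGroup (3 + 3 * m)))) (3 + 3 * m)) →
      (∀ i j, i ≠ j → IsFreeOfRank (K.pairQuotient i j) (m + 1)) →
      Nonempty (K.tripleQuotient ≃* (PUnit : Type)) →
      ∀ i j : Fin 3, i ≠ j → ∃ α : SurfaceGroup (3 + 3 * m) ≃* SurfaceGroup (3 + 3 * m),
        (s4Kernels.stabilizeIter m i).map α.toMonoidHom = K i ∧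
        (s4Kernels.stabilizeIter m j).map α.toMonoidHom = K j) := by
  intro h
  have hN := s4Kernels_isGroupTrisection_holds
  have hfree : ∀ i, IsFreeOfRank (SurfaceGroup 3 ⧸
      normalClosure ((badK i : Subgroup (SurfaceGroup 3)) : Set (SurfaceGroup 3))) 3 := fun i =>
    (hN.free_quotient i).of_mulEquiv (QuotientGroup.quotientMulEquivOfEq (normalClosure_badK i).symm)
  have hpair : ∀ i j : Fin 3, i ≠ j → IsFreeOfRank (badK.pairQuotient i j) (0 + 1) := fun i j hij =>
    (hN.free_pairQuotient i j hij).of_mulEquiv (QuotientGroup.quotientMulEquivOfEq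
      (normalClosure_union_congr (normalClosure_badK i).symm (normalClosure_badK j).symm))
  have htriple : Nonempty (badK.tripleQuotient ≃* (PUnit : Type)) := by
    obtain ⟨e⟩ := hN.triple
    exact ⟨(QuotientGroup.quotientMulEquivOfEq
      (normalClosure_iUnion_congr fun i => (normalClosure_badK i).symm)).symm.trans e⟩
  obtain ⟨α, h0, -⟩ := h 0 badK hfree hpair htriple 0 1 (by decide)
  have h0' : (s4Kernels 0).map (α : SurfaceGroup 3 →* SurfaceGroup 3) = badK0 := h0
  have hn : (badK0).Normal := by
    rw [← h0']
    exact Subgroup.Normal.map (hN.normal 0) _ α.surjective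
  exact badK0_not_normal hn

end Summit.SmoothPoincare4.SmoothPoincare4.Theorems.WaldhausenPairs.Negative

end
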